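import Summits.QuantumAdvantage.QuantumAdvantage.Theses.XorDarkCharacters

/-!
# Route `XorDarkCharacters`, support `ZSectorRange` (stmt-QuantumAdvantage-9871)

The `a = 0` sector of the character-state estimate is the Walsh spectrum of the indicator of the range
`[1, p)`: for `0 < b < 2ⁿ` and `p ≤ 2ⁿ`,
`|∑_{0 < x < p} (−1)^{b·x}| ≤ 2ⁿ − p + 1`.
Proof: the full cube `[0, 2ⁿ)` sums to `0` (flipping a set bit `i₀` of `b` is a sign-reversing involution
of the cube), and the complement consists of `x = 0` (one term) and `[p, 2ⁿ)` (`2ⁿ − p` terms of modulus `1`).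

HONEST FRAMING (block-2b rule): the value here is a closed ledger item (an elementary kernel-checked
lemma), NOT summit progress.

References: elementary (orthogonality of Walsh characters); planner NOTES.md §audit 3 of route
`XorDarkCharacters`. [folklore]
-/

set_option linter.dupNamespace false -- D-0017: single-problem summit ⇒ `QuantumAdvantage.QuantumAdvantage` by design

namespace Summit.QuantumAdvantage.QuantumAdvantage.Theorems.ZSectorRange

open Finset

/-- The Walsh sign `w_b(x) = ∏_{i<n} (−1)^{b_i x_i}` (exactly the summand of the route statement; a local
notation, not a definition). -/
local notation3 "𝔴[" n ", " b ", " x "]" =>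
  (∏ i ∈ Finset.range n, (if Nat.testBit b i ∧ Nat.testBit x i then (-1 : ℝ) else 1))

/-- `|w_b(x)| = 1`. [folklore] -/
theorem abs_walsh (n b x : ℕ) : |𝔴[n, b, x]| = 1 := by
  rw [Finset.abs_prod]
  refine Finset.prod_eq_one fun i _ => ?_
  split_ifs <;> simp

/-- `w_b(0) = 1`. [folklore] -/
theorem walsh_zero (n b : ℕ) : 𝔴[n, b, 0] = 1 := by
  refine Finset.prod_eq_one fun i _ => ?_
  simp

/-- Flipping a bit `i₀ < n` that is set in `b` reverses the sign of `w_b`. [folklore] -/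
theorem walsh_xor_two_pow {n b x i₀ : ℕ} (hi₀ : i₀ < n) (hb : b.testBit i₀ = true) :
    𝔴[n, b, x ^^^ 2 ^ i₀] = -𝔴[n, b, x] := by
  rw [← Finset.mul_prod_erase (range n) _ (Finset.mem_range.2 hi₀),
    ← Finset.mul_prod_erase (range n) (fun i => if b.testBit i ∧ x.testBit i then (-1 : ℝ) else 1)
      (Finset.mem_range.2 hi₀)]
  have h1 : ∀ i ∈ (range n).erase i₀,
      (if b.testBit i ∧ (x ^^^ 2 ^ i₀).testBit i then (-1 : ℝ) else 1) =
        (if b.testBit i ∧ x.testBit i then (-1 : ℝ) else 1) := by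
    intro i hi
    have hne : i₀ ≠ i := (Finset.ne_of_mem_erase hi).symm
    rw [Nat.testBit_xor, Nat.testBit_two_pow_of_ne hne, Bool.xor_false]
  rw [Finset.prod_congr rfl h1, Nat.testBit_xor, Nat.testBit_two_pow_self, hb]
  cases x.testBit i₀ <;> simp

/-- **Orthogonality**: for `0 < b < 2ⁿ` the Walsh character `w_b` sums to `0` over the cube `[0, 2ⁿ)`.
[folklore] -/
theorem sum_walsh_range_two_pow {n b : ℕ} (hb0 : 0 < b) (hbn : b < 2 ^ n) :
    ∑ x ∈ range (2 ^ n), 𝔴[n, b, x] = 0 := by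
  obtain ⟨i₀, hi₀⟩ := Nat.exists_testBit_of_ne_zero hb0.ne'
  have hi₀n : i₀ < n := by
    by_contra h
    have : b < 2 ^ i₀ := lt_of_lt_of_le hbn (Nat.pow_le_pow_right (by norm_num) (not_lt.1 h))
    rw [Nat.testBit_lt_two_pow this] at hi₀
    exact Bool.false_ne_true hi₀
  have hc : 2 ^ i₀ < 2 ^ n := Nat.pow_lt_pow_right (by norm_num) hi₀n
  have hmem : ∀ x ∈ range (2 ^ n), x ^^^ 2 ^ i₀ ∈ range (2 ^ n) := fun x hx =>
    Finset.mem_range.2 (Nat.xor_lt_two_pow (Finset.mem_range.1 hx) hc)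
  have hinv : ∀ x : ℕ, (x ^^^ 2 ^ i₀) ^^^ 2 ^ i₀ = x := fun x => by
    rw [Nat.xor_assoc, Nat.xor_self, Nat.xor_zero]
  have key : ∑ x ∈ range (2 ^ n), 𝔴[n, b, x] = ∑ x ∈ range (2 ^ n), 𝔴[n, b, x ^^^ 2 ^ i₀] :=
    Finset.sum_nbij' (fun x => x ^^^ 2 ^ i₀) (fun x => x ^^^ 2 ^ i₀) hmem hmem
      (fun x _ => hinv x) (fun x _ => hinv x) (fun x _ => by rw [hinv])
  have key' : ∑ x ∈ range (2 ^ n), 𝔴[n, b, x ^^^ 2 ^ i₀] = -∑ x ∈ range (2 ^ n), 𝔴[n, b, x] := by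
    rw [← Finset.sum_neg_distrib]
    exact Finset.sum_congr rfl fun x _ => walsh_xor_two_pow hi₀n hi₀
  rw [key'] at key
  linarith

/-- The sum of `2ⁿ − p` signs over `[p, 2ⁿ)` has modulus at most `2ⁿ − p`. [folklore] -/
theorem abs_sum_walsh_Ico_le {n b p : ℕ} (hp : p ≤ 2 ^ n) :
    |∑ x ∈ Ico p (2 ^ n), 𝔴[n, b, x]| ≤ (2 : ℝ) ^ n - p := by
  refine (Finset.abs_sum_le_sum_abs _ _).trans ?_
  simp only [abs_walsh, Finset.sum_const, Nat.card_Ico, nsmul_eq_mul, mul_one]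
  rw [Nat.cast_sub hp, Nat.cast_pow, Nat.cast_ofNat]

/-- **`XorDarkCharacters.ZSectorRange`** (stmt-QuantumAdvantage-9871): for `p ≤ 2ⁿ` and `0 < b < 2ⁿ`,
`|∑_{x ∈ [1,p)} ∏_{i<n} (−1)^{[b_i ∧ x_i]}| ≤ 2ⁿ − p + 1`. [folklore] -/
theorem zSectorRange_proof :
    Summit.QuantumAdvantage.QuantumAdvantage.Theses.XorDarkCharacters.ZSectorRange := by
  unfold Summit.QuantumAdvantage.QuantumAdvantage.Theses.XorDarkCharacters.ZSectorRange
  intro p n b hp hb0 hbn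
  have hp' : (p : ℝ) ≤ (2 : ℝ) ^ n := by exact_mod_cast hp
  rcases Nat.eq_zero_or_pos p with rfl | hp1
  · rw [Finset.Ico_eq_empty_of_le zero_le_one, Finset.sum_empty, abs_zero, Nat.cast_zero, sub_zero]
    positivity
  -- split the cube `[0, 2ⁿ) = {0} ∪ [1, p) ∪ [p, 2ⁿ)`
  have h0 := sum_walsh_range_two_pow hb0 hbn
  rw [Finset.range_eq_Ico, ← Finset.sum_Ico_consecutive _ (Nat.zero_le 1) Nat.one_le_two_pow,
    ← Finset.sum_Ico_consecutive _ hp1 hp, Finset.sum_Ico_succ_top (Nat.zero_le 0), Finset.Ico_self,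
    Finset.sum_empty, zero_add, walsh_zero] at h0
  have h1 : ∑ x ∈ Ico 1 p, 𝔴[n, b, x] = -1 - ∑ x ∈ Ico p (2 ^ n), 𝔴[n, b, x] := by linarith
  rw [h1, show (-1 : ℝ) - ∑ x ∈ Ico p (2 ^ n), 𝔴[n, b, x] = -(1 + ∑ x ∈ Ico p (2 ^ n), 𝔴[n, b, x]) by ring,
    abs_neg]
  calc |1 + ∑ x ∈ Ico p (2 ^ n), 𝔴[n, b, x]|
      ≤ |(1 : ℝ)| + |∑ x ∈ Ico p (2 ^ n), 𝔴[n, b, x]| := abs_add_le _ _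
    _ ≤ 1 + ((2 : ℝ) ^ n - p) := by rw [abs_one]; linarith [abs_sum_walsh_Ico_le (b := b) hp]
    _ = (2 : ℝ) ^ n - p + 1 := by ring

end Summit.QuantumAdvantage.QuantumAdvantage.Theorems.ZSectorRange
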